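import Literature.Probability.Exchangeability.LimitStatistic
import HarnessLib

/-!
# de Finetti's theorem, I: the product formula

Under an exchangeable probability law `P` on `ℕ → E`:

* `IsExchangeable.integral_prod_blockAvg_apBlock_eq` — **block sampling identity**: replacing
  `fᵢ (x i)` by the average of `fᵢ` over the block `{i + k j : j < n}` does not change
  `E ∏_{i<k} fᵢ (x i)` (every index tuple `(i + k jᵢ)ᵢ` is injective) — the exact identity behind
  Kallenberg's choice of sampling distributions in the proof of Thm 11.10;
* `IsExchangeable.integral_prod_eq_integral_prod_limAvg` — **product formula**:
  `∫ ∏_{i<k} fᵢ (x i) dP = ∫ ∏_{i<k} limAvg fᵢ dP` for bounded measurable `fᵢ`;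
* `IsExchangeable.measure_pi_eq_lintegral_prod` — **box formula**:
  `P {x | ∀ i < k, x i ∈ tᵢ} = ∫ ∏_{i<k} ν_x (tᵢ) P(dx)` with `ν = directingKernel P`
  (`E` standard Borel).

The mixture formula, the empirical-limit clause and the packaged statement are in
`DeFinetti.lean`.

## References

* O. Kallenberg, *Foundations of Modern Probability*, 2nd ed., Springer 2002, Thm 11.10 (proof
  via Lemma 11.9). [Kallenberg2002]
-/

namespace Literature.Probability.Exchangeability

open _root_.MeasureTheory _root_.ProbabilityTheory Equiv Function Set Finset Filter
open scoped Topology ENNReal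

variable {E : Type*}

/-! ### Arithmetic-progression blocks -/

/-- `j ↦ i + k j` is injective for `k > 0`. [folklore] -/
theorem apBlock_injective {i k : ℕ} (hk : 0 < k) : Injective fun j : ℕ => i + k * j :=
  fun _ _ hab => Nat.eq_of_mul_eq_mul_left hk (Nat.add_left_cancel hab)

/-- `|apBlock i k n| = n` for `k > 0`. [folklore] -/
theorem card_apBlock {i k : ℕ} (hk : 0 < k) (n : ℕ) : (apBlock i k n).card = n := by
  rw [apBlock, Finset.card_image_of_injective _ (apBlock_injective hk), Finset.card_range]

/-- `apBlock i k n ⊆ {0, …, kn - 1}` for `i < k`. [folklore] -/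
theorem apBlock_subset_range {i k : ℕ} (hik : i < k) (n : ℕ) :
    apBlock i k n ⊆ Finset.range (k * n) := by
  intro a ha
  rw [apBlock, Finset.mem_image] at ha
  obtain ⟨j, hj, rfl⟩ := ha
  rw [Finset.mem_range] at hj ⊢
  calc i + k * j < k + k * j := by omega
    _ = k * (j + 1) := by ring
    _ ≤ k * n := Nat.mul_le_mul_left k hj

/-- The block average over `apBlock i k n`, as a sum over `j < n`. [folklore] -/
theorem blockAvg_apBlock {i k : ℕ} (hk : 0 < k) (n : ℕ) (f : E → ℝ) (x : ℕ → E) :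
    blockAvg (apBlock i k n) f x = (n : ℝ)⁻¹ * ∑ j ∈ Finset.range n, f (x (i + k * j)) := by
  rw [blockAvg_def, card_apBlock hk, apBlock,
    Finset.sum_image fun _ _ _ _ hab => apBlock_injective hk hab]

/-- Telescoping bound for products of numbers of modulus `≤ 1`:
`|∏ aᵢ - ∏ bᵢ| ≤ ∑ |aᵢ - bᵢ|`. [folklore] -/
theorem abs_prod_sub_prod_le {k : ℕ} (a b : Fin k → ℝ) (ha : ∀ i, |a i| ≤ 1)
    (hb : ∀ i, |b i| ≤ 1) : |∏ i, a i - ∏ i, b i| ≤ ∑ i, |a i - b i| := by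
  induction k with
  | zero => simp
  | succ k ih =>
    rw [Fin.prod_univ_succ, Fin.prod_univ_succ, Fin.sum_univ_succ]
    set A := ∏ i : Fin k, a i.succ
    set B := ∏ i : Fin k, b i.succ
    have hB : |B| ≤ 1 := by
      rw [Finset.abs_prod]
      exact Finset.prod_le_one (fun i _ => abs_nonneg _) fun i _ => hb _
    have hAB : |A - B| ≤ ∑ i : Fin k, |a i.succ - b i.succ| :=
      ih (fun i => a i.succ) (fun i => b i.succ) (fun i => ha _) fun i => hb _
    calc |a 0 * A - b 0 * B| = |a 0 * (A - B) + (a 0 - b 0) * B| := by ring_nf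
      _ ≤ |a 0| * |A - B| + |a 0 - b 0| * |B| := by
          refine (abs_add_le _ _).trans ?_
          rw [abs_mul, abs_mul]
      _ ≤ 1 * |A - B| + |a 0 - b 0| * 1 := by
          gcongr
          · exact ha 0
      _ ≤ |a 0 - b 0| + ∑ i : Fin k, |a i.succ - b i.succ| := by linarith

variable [MeasurableSpace E]

namespace IsExchangeable

variable {P : Measure (ℕ → E)} [IsProbabilityMeasure P]

/-- **Block sampling identity**: under an exchangeable law, replacing `f_i (x i)` by the average
of `f_i` over the block `{i + k j : j < n}` does not change the expectation of the product
(every index tuple `(i + k jᵢ)ᵢ` is injective).  This is the exact identity behind Kallenberg's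
choice of sampling distributions in the proof of Thm 11.10.
[cite: Kallenberg2002, Thm 11.10 (proof)] -/
theorem integral_prod_blockAvg_apBlock_eq (h : IsExchangeable P) {k : ℕ} (hk : 0 < k)
    (f : Fin k → E → ℝ) (hf : ∀ i, Measurable (f i)) (h1 : ∀ i z, |f i z| ≤ 1) {n : ℕ}
    (hn : 0 < n) :
    ∫ x, ∏ i : Fin k, blockAvg (apBlock i k n) (f i) x ∂P = ∫ x, ∏ i, f i (x i) ∂P := by
  classical
  have hexp : ∀ x : ℕ → E, ∏ i : Fin k, blockAvg (apBlock i k n) (f i) x =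
      ((n : ℝ)⁻¹) ^ k * ∑ J ∈ Fintype.piFinset (fun _ : Fin k => Finset.range n),
        ∏ i, f i (x (i + k * J i)) := by
    intro x
    simp_rw [blockAvg_apBlock hk]
    rw [Finset.prod_mul_distrib, Finset.prod_const, Finset.card_univ, Fintype.card_fin,
      Finset.prod_univ_sum]
  have hint : ∀ J : Fin k → ℕ, Integrable (fun x : ℕ → E => ∏ i, f i (x (i + k * J i))) P := by
    intro J
    refine integrable_of_abs_le (Finset.measurable_prod _ fun i _ =>
      (hf i).comp (measurable_pi_apply _)) (M := 1) fun x => ?_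
    rw [Finset.abs_prod]
    exact Finset.prod_le_one (fun i _ => abs_nonneg _) fun i _ => h1 _ _
  have hinj : ∀ J : Fin k → ℕ, Injective fun i : Fin k => (i : ℕ) + k * J i := by
    intro J a b hab
    have := congrArg (· % k) hab
    simp only [Nat.add_mul_mod_self_left, Nat.mod_eq_of_lt a.2, Nat.mod_eq_of_lt b.2] at this
    exact Fin.ext this
  simp_rw [hexp]
  rw [integral_const_mul, integral_finsetSum _ fun J _ => hint J,
    Finset.sum_congr rfl fun J _ =>
      h.integral_sample_eq (fun i : Fin k => (i : ℕ) + k * J i) (hinj J) (fun y => ∏ i, f i (y i)),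
    Finset.sum_const, Fintype.card_piFinset_const, Finset.card_range, nsmul_eq_mul]
  have hn' : (n : ℝ) ≠ 0 := by exact_mod_cast hn.ne'
  push_cast
  rw [← mul_assoc, ← mul_pow, inv_mul_cancel₀ hn', one_pow, one_mul]

/-- **`L¹` convergence of the block averages over `{i + k j : j < n}`** to the limit statistic,
as `n → ∞`. [folklore] -/
theorem tendsto_integral_abs_blockAvg_apBlock_sub_limAvg (h : IsExchangeable P) {f : E → ℝ}
    (hf : Measurable f) (h1 : ∀ z, |f z| ≤ 1) {i k : ℕ} (hik : i < k) :
    Tendsto (fun n => ∫ x, |blockAvg (apBlock i k n) f x - limAvg f x| ∂P) atTop (𝓝 0) := by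
  have hk : 0 < k := by omega
  -- the key estimate: for every n ≥ 1 and t > 0, ∫ |avg_B - limAvg| ≤ t/2 + 1/(n t)
  have key : ∀ n : ℕ, 0 < n → ∀ t : ℝ, 0 < t →
      ∫ x, |blockAvg (apBlock i k n) f x - limAvg f x| ∂P ≤ t / 2 + 1 / (n * t) := by
    intro n hn t ht
    set B := apBlock i k n with hB
    have hBn : B.Nonempty := by
      rw [← Finset.card_pos, hB, card_apBlock hk]; exact hn
    have hmB : Measurable (blockAvg B f) := measurable_blockAvg B hf
    -- compare with the averages over `range (4^m)` for large `m`
    have hev : ∀ᶠ m in atTop, ∫ x, |blockAvg B f x - limAvg f x| ∂P ≤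
        t / 2 + 1 / (n * t) +
          ∫ x, |blockAvg (Finset.range (4 ^ m)) f x - limAvg f x| ∂P := by
      filter_upwards [eventually_ge_atTop (k * n)] with m hm
      set S := Finset.range (4 ^ m) with hS
      have hBS : B ⊆ S :=
        (apBlock_subset_range hik n).trans (Finset.range_subset_range.mpr (hm.trans (le_four_pow m)))
      have hmS : Measurable (blockAvg S f) := measurable_blockAvg S hf
      have hi1 : Integrable (fun x => |blockAvg B f x - blockAvg S f x|) P :=
        (integrable_of_abs_le (hmB.sub hmS) (M := 2) fun x => (abs_sub _ _).trans
          (by linarith [abs_blockAvg_le h1 zero_le_one B x, abs_blockAvg_le h1 zero_le_one S x])).abs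
      have hi2 : Integrable (fun x => |blockAvg S f x - limAvg f x|) P :=
        ((integrable_of_abs_le hmS (abs_blockAvg_le h1 zero_le_one S)).sub
          (h.integrable_limAvg hf h1)).abs
      have hsq : ∫ x, (blockAvg B f x - blockAvg S f x) ^ 2 ∂P ≤ 2 * (n : ℝ)⁻¹ := by
        have := h.integral_blockAvg_sub_sq_le hf h1 hBS hBn
        rw [hB, card_apBlock hk] at this
        simpa [hB] using this
      have hi3 : Integrable (fun x => (blockAvg B f x - blockAvg S f x) ^ 2) P := by
        refine integrable_of_abs_le ((hmB.sub hmS).pow_const 2) (M := 2 ^ 2) fun x => ?_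
        rw [abs_pow]
        refine pow_le_pow_left₀ (abs_nonneg _) ((abs_sub _ _).trans ?_) 2
        linarith [abs_blockAvg_le h1 zero_le_one B x, abs_blockAvg_le h1 zero_le_one S x]
      calc ∫ x, |blockAvg B f x - limAvg f x| ∂P
          ≤ ∫ x, |blockAvg B f x - blockAvg S f x| + |blockAvg S f x - limAvg f x| ∂P := by
            refine integral_mono_of_nonneg (Eventually.of_forall fun _ => abs_nonneg _)
              (hi1.add hi2) (Eventually.of_forall fun x => ?_)
            exact abs_sub_le _ _ _
        _ = ∫ x, |blockAvg B f x - blockAvg S f x| ∂P + ∫ x, |blockAvg S f x - limAvg f x| ∂P :=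
            integral_add hi1 hi2
        _ ≤ (t / 2 + (∫ x, (blockAvg B f x - blockAvg S f x) ^ 2 ∂P) / (2 * t)) +
              ∫ x, |blockAvg S f x - limAvg f x| ∂P := by
            gcongr
            calc ∫ x, |blockAvg B f x - blockAvg S f x| ∂P
                ≤ ∫ x, t / 2 + (blockAvg B f x - blockAvg S f x) ^ 2 / (2 * t) ∂P :=
                  integral_mono_of_nonneg (Eventually.of_forall fun _ => abs_nonneg _)
                    ((integrable_const _).add (hi3.div_const _))
                    (Eventually.of_forall fun x => abs_le_half_add_sq_div ht)
              _ = t / 2 + (∫ x, (blockAvg B f x - blockAvg S f x) ^ 2 ∂P) / (2 * t) := by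
                  rw [integral_add (integrable_const _) (hi3.div_const _), integral_const,
                    integral_div]
                  simp
        _ ≤ (t / 2 + (2 * (n : ℝ)⁻¹) / (2 * t)) + ∫ x, |blockAvg S f x - limAvg f x| ∂P := by
            gcongr
        _ = t / 2 + 1 / (n * t) + ∫ x, |blockAvg S f x - limAvg f x| ∂P := by
            congr 1
            field_simp
    have hlim : Tendsto (fun m => t / 2 + 1 / (n * t) +
        ∫ x, |blockAvg (Finset.range (4 ^ m)) f x - limAvg f x| ∂P) atTop
        (𝓝 (t / 2 + 1 / (n * t) + 0)) :=
      tendsto_const_nhds.add (h.tendsto_integral_abs_blockAvg_sub_limAvg hf h1)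
    have := ge_of_tendsto hlim hev
    simpa using this
  rw [Metric.tendsto_atTop]
  intro ε hε
  refine ⟨⌈2 / ε ^ 2⌉₊ + 1, fun n hn => ?_⟩
  have hn0 : 0 < n := by omega
  have hnR : (2 : ℝ) / ε ^ 2 < n := by
    have h1' := Nat.le_ceil (2 / ε ^ 2)
    have h2' : (⌈2 / ε ^ 2⌉₊ : ℝ) + 1 ≤ n := by exact_mod_cast hn
    linarith
  have hnpos : (0 : ℝ) < n := by exact_mod_cast hn0
  rw [Real.dist_eq, sub_zero, abs_of_nonneg (integral_nonneg fun _ => abs_nonneg _)]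
  have h2 : (2 : ℝ) < n * ε ^ 2 := by rwa [div_lt_iff₀ (by positivity)] at hnR
  have h3 : 1 / (n * ε) < ε / 2 := by
    rw [div_lt_div_iff₀ (by positivity) (by positivity)]
    nlinarith
  calc ∫ x, |blockAvg (apBlock i k n) f x - limAvg f x| ∂P ≤ ε / 2 + 1 / (n * ε) :=
        key n hn0 ε hε
    _ < ε / 2 + ε / 2 := by linarith
    _ = ε := by ring

/-- **Product formula**: for bounded (`|fᵢ| ≤ 1`) measurable `f₀, …, f_{k-1}`,
`∫ ∏_{i<k} fᵢ (x i) dP = ∫ ∏_{i<k} limAvg fᵢ dP` — the finite-dimensional laws of an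
exchangeable sequence are mixtures of products. [cite: Kallenberg2002, Thm 11.10 (proof, via Lemma 11.9)] -/
theorem integral_prod_eq_integral_prod_limAvg (h : IsExchangeable P) {k : ℕ} (f : Fin k → E → ℝ)
    (hf : ∀ i, Measurable (f i)) (h1 : ∀ i z, |f i z| ≤ 1) :
    ∫ x, ∏ i, f i (x i) ∂P = ∫ x, ∏ i, limAvg (f i) x ∂P := by
  rcases Nat.eq_zero_or_pos k with rfl | hk
  · simp
  set a : ℕ → ℝ := fun n => ∫ x, ∏ i : Fin k, blockAvg (apBlock i k n) (f i) x ∂P with ha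
  set R := ∫ x, ∏ i, limAvg (f i) x ∂P with hR
  -- a n → R
  have hbound : ∀ n, |a n - R| ≤
      ∑ i : Fin k, ∫ x, |blockAvg (apBlock i k n) (f i) x - limAvg (f i) x| ∂P := by
    intro n
    have hae : ∀ᵐ x ∂P, ∀ i : Fin k, |limAvg (f i) x| ≤ 1 :=
      ae_all_iff.mpr fun i => h.ae_abs_limAvg_le (hf i) (h1 i)
    have hi1 : Integrable (fun x => ∏ i : Fin k, blockAvg (apBlock i k n) (f i) x) P := by
      refine integrable_of_abs_le (Finset.measurable_prod _ fun i _ =>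
        measurable_blockAvg _ (hf i)) (M := 1) fun x => ?_
      rw [Finset.abs_prod]
      exact Finset.prod_le_one (fun i _ => abs_nonneg _) fun i _ =>
        abs_blockAvg_le (h1 i) zero_le_one _ _
    have hi2 : Integrable (fun x => ∏ i, limAvg (f i) x) P := by
      refine (integrable_const (1 : ℝ)).mono'
        (Finset.measurable_prod _ fun i _ => measurable_limAvg (hf i)).aestronglyMeasurable ?_
      filter_upwards [hae] with x hx
      rw [Real.norm_eq_abs, Finset.abs_prod]
      exact Finset.prod_le_one (fun i _ => abs_nonneg _) fun i _ => hx i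
    have hi3 : ∀ i : Fin k, Integrable
        (fun x => |blockAvg (apBlock i k n) (f i) x - limAvg (f i) x|) P := fun i =>
      ((integrable_of_abs_le (measurable_blockAvg _ (hf i))
        (abs_blockAvg_le (h1 i) zero_le_one _)).sub (h.integrable_limAvg (hf i) (h1 i))).abs
    calc |a n - R| = |∫ x, (∏ i : Fin k, blockAvg (apBlock i k n) (f i) x -
          ∏ i, limAvg (f i) x) ∂P| := by
          rw [ha, hR, integral_sub hi1 hi2]
      _ ≤ ∫ x, |∏ i : Fin k, blockAvg (apBlock i k n) (f i) x - ∏ i, limAvg (f i) x| ∂P :=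
          abs_integral_le_integral_abs
      _ ≤ ∫ x, ∑ i : Fin k, |blockAvg (apBlock i k n) (f i) x - limAvg (f i) x| ∂P := by
          refine integral_mono_ae (hi1.sub hi2).abs (integrable_finsetSum _ fun i _ => hi3 i) ?_
          filter_upwards [hae] with x hx
          exact abs_prod_sub_prod_le _ _ (fun i => abs_blockAvg_le (h1 i) zero_le_one _ _) hx
      _ = ∑ i : Fin k, ∫ x, |blockAvg (apBlock i k n) (f i) x - limAvg (f i) x| ∂P :=
          integral_finsetSum _ fun i _ => hi3 i
  have htend : Tendsto a atTop (𝓝 R) := by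
    have h0 : Tendsto (fun n => ∑ i : Fin k,
        ∫ x, |blockAvg (apBlock i k n) (f i) x - limAvg (f i) x| ∂P) atTop (𝓝 0) := by
      have := tendsto_finsetSum (Finset.univ : Finset (Fin k)) fun i _ =>
        h.tendsto_integral_abs_blockAvg_apBlock_sub_limAvg (hf i) (h1 i) (i := (i : ℕ)) (k := k) i.2
      simpa using this
    have h0' : Tendsto (fun n => a n - R) atTop (𝓝 0) :=
      squeeze_zero_norm (fun n => by simpa [Real.norm_eq_abs] using hbound n) h0
    have := h0'.add_const R
    simpa using this
  -- but a n = LHS for n ≥ 1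
  have hconst : ∀ᶠ n in atTop, a n = ∫ x, ∏ i, f i (x i) ∂P := by
    filter_upwards [eventually_ge_atTop 1] with n hn
    exact h.integral_prod_blockAvg_apBlock_eq hk f hf h1 hn
  have htend' : Tendsto a atTop (𝓝 (∫ x, ∏ i, f i (x i) ∂P)) :=
    tendsto_const_nhds.congr' (EventuallyEq.symm hconst)
  exact tendsto_nhds_unique htend' htend

variable [StandardBorelSpace E]

/-- **Box formula**: for measurable `t₀, …, t_{k-1} ⊆ E`,
`P {x | ∀ i < k, x i ∈ tᵢ} = ∫ ∏_{i<k} ν_x (tᵢ) P(dx)` with `ν = directingKernel P`: the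
finite-dimensional laws are mixtures of products of the directing measure.
[cite: Kallenberg2002, Thm 11.10] -/
theorem measure_pi_eq_lintegral_prod (h : IsExchangeable P) {k : ℕ} (t : Fin k → Set E)
    (ht : ∀ i, MeasurableSet (t i)) :
    P {x | ∀ i : Fin k, x i ∈ t i} = ∫⁻ x, ∏ i, directingKernel P x (t i) ∂P := by
  classical
  set S := {x : ℕ → E | ∀ i : Fin k, x i ∈ t i} with hS
  have hSm : MeasurableSet S := by
    have : S = ⋂ i : Fin k, (fun x : ℕ → E => x (i : ℕ)) ⁻¹' t i := by
      ext x; simp [hS]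
    rw [this]
    exact MeasurableSet.iInter fun i => measurable_pi_apply _ (ht i)
  have hbd : ∀ (i : Fin k) (z : E), |(t i).indicator (1 : E → ℝ) z| ≤ 1 := fun i z => by
    by_cases hz : z ∈ t i <;> simp [hz]
  have hprod := h.integral_prod_eq_integral_prod_limAvg (fun i => (t i).indicator (1 : E → ℝ))
    (fun i => measurable_one.indicator (ht i)) hbd
  -- left side = P.real S
  have hL : ∫ x, ∏ i, (t i).indicator (1 : E → ℝ) (x i) ∂P = P.real S := by
    rw [← integral_indicator_one hSm]
    refine integral_congr_ae (Eventually.of_forall fun x => ?_)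
    simp only [Set.indicator_apply, Pi.one_apply, Finset.prod_boole, Finset.mem_univ,
      true_imp_iff, hS, Set.mem_setOf_eq]
  -- right side = (∫⁻ ∏ ν (t i)).toReal
  have hae : ∀ᵐ x ∂P, ∀ i : Fin k,
      (directingKernel P x).real (t i) = limAvg ((t i).indicator 1) x :=
    ae_all_iff.mpr fun i => h.directingKernel_real_ae_eq_limAvg (ht i)
  have hR : ∫ x, ∏ i, limAvg ((t i).indicator (1 : E → ℝ)) x ∂P =
      (∫⁻ x, ∏ i, directingKernel P x (t i) ∂P).toReal := by
    have hmeas : AEMeasurable (fun x => ∏ i, directingKernel P x (t i)) P :=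
      (Finset.measurable_prod _ fun i _ => (directingKernel P).measurable_coe (ht i)).aemeasurable
    rw [← integral_toReal hmeas (Eventually.of_forall fun x => ?_)]
    · refine integral_congr_ae ?_
      filter_upwards [hae] with x hx
      rw [ENNReal.toReal_prod]
      exact Finset.prod_congr rfl fun i _ => (hx i).symm
    · exact (Finset.prod_le_one' fun i _ => prob_le_one).trans_lt ENNReal.one_lt_top
  have hfin : ∫⁻ x, ∏ i, directingKernel P x (t i) ∂P ≠ ∞ := by
    refine ne_top_of_le_ne_top (measure_ne_top P Set.univ) ?_
    calc ∫⁻ x, ∏ i, directingKernel P x (t i) ∂P ≤ ∫⁻ _x, 1 ∂P :=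
          lintegral_mono fun x => Finset.prod_le_one' fun i _ => prob_le_one
      _ = P Set.univ := by simp
  rw [hL, hR, measureReal_def] at hprod
  exact (ENNReal.toReal_eq_toReal_iff' (measure_ne_top P S) hfin).mp hprod

end IsExchangeable

end Literature.Probability.Exchangeability
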